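import Summits.BirchSwinnertonDyer.BirchSwinnertonDyer.Theorems.ManinLocalTwoThreeShimuraPrimeLevelAtTwo
import HarnessLib

/-!
# The Shimura-cover kernel at 5 forces level 11 (cell bsd-f2-manin, es g43; MEMO-es §65): `5 ∣ [Λ₀(f) : Λ₁(f)]` forces `11 ∣ N`; the Derickx–Orlić law at every prime level `q ∉ {11, 17}`

Cell bsd-f2-manin, seat es (planner), gen 43.  Typed rows over tree declarations; NOTHING is asserted here — every row is an
`@[conjecture] def … : Prop`.  Rows E-es-221/222/223/225 are THEOREMS, closed by name in
`Theorems/ManinLocalTwoThreeShimuraFiveElevenHolds.lean` from `Theorems/ManinLocalTwoThreeShimuraFiveForcesEleven.lean` /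
`…ShimuraFiveTransport.lean` (decls `ShimuraFive.eleven_dvd_level_of_not_shimuraIndexPrimeTo_five`,
`ShimuraFive.two_mul_mem_or_three_mul_mem_primeLevel_of_ne(')`, `ShimuraFive.periodLattice_le_gamma1_of_frobeniusTrace_two_eq_neg_two`;
the `_holds` terms are recorded in the docstrings); row E-es-224 is the CONJECTURAL residual — OPEN exactly on `{5 ∣ N} ∪ {p² ∣ N}`:
on `{N squarefree, 5 ∤ N}` it is Byeon–Kim 2014, Thm. 1.1 [cite: ByeonKim2014, Thm. 1.1] (in the `E₀/E₁` currency, modulo Stevens),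
at prime level a corollary of E-es-222 — with its E15 falsifier.  `hopt` = LATTICE-optimality of the `X₀(N)`-datum
(`Λ(D.L) = c·Λ₀(f)`), the standing normalisation of the cell's Shimura-kernel rows.

Falsifier (HOME/es/g43/E221-shimurafive-eleven-check-g43.txt, sha16 0604be1bc6cebc97; E15 table, 1025 classes, N ≤ 19870):
E221 — `5 ∣ n` at exactly 1 class (11a1, `11 ∣ 11`), 0 violations; habitat: 17 classes with a rational 5-torsion point and
`11 ∤ N`, all `n = 1`; E222 — 61 prime levels, `q ∈ {11, 17}`: n = 5, 4; the other 59: n ∈ {1 (35), 2 (22), 3 (2)}, 0 violations;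
E223 — 39 instances (odd `N`, `11 ∤ N`, `a₂ = −2`), all `n = 1`; E224 — `5 ∣ n ⟹ N = 11`: consistent (1/1025; the 3 classes with
`11 ∣ N`, `N > 11` and a rational 5-point have `n = 1`).
-/

set_option autoImplicit false

noncomputable section

open scoped MatrixGroups ModularForm

open CongruenceSubgroup Complex WeierstrassCurve Literature.NumberTheory.EllipticCurves
  Literature.NumberTheory.EllipticCurves.ModularForms
open Summit.BirchSwinnertonDyer.Rank1Residual.ManinAdditive Summit.BirchSwinnertonDyer.Rank1Residual.ManinAdditive.KatoCurve

namespace Summit.BirchSwinnertonDyer.Rank1Residual.ManinAdditive.EsG43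

/-- **E-es-221 `ElevenDividesLevelOfShimuraFive`** (THEOREM, T-es-83: `_holds := fun W₀ _ _ _ _ D₀ hopt hS ↦
ShimuraFive.eleven_dvd_level_of_not_shimuraIndexPrimeTo_five W₀ D₀ hopt hS`).  For a globally minimal `W₀` with a
lattice-optimal `X₀(N)`-datum: if the Shimura-cover kernel `Λ₀(f)/Λ₁(f)` has an element of order `5`, then `11 ∣ N`.
[cite: Vatsal2005, Rem. 1.8] [cite: LingOesterle1991, §1 Cor. 1] -/
@[conjecture]
def ElevenDividesLevelOfShimuraFive : Prop :=
  ∀ (W₀ : WeierstrassCurve ℚ) [W₀.IsElliptic] [W₀.IsGloballyMinimal] {N : ℕ} [NeZero N]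
    (D₀ : ModularParametrizationData W₀ N), (∀ z ∈ D₀.L.lattice, ∃ w ∈ periodLattice D₀.f, z = D₀.c * w) →
    ¬ ShimuraIndexPrimeTo 5 D₀.f → 11 ∣ N

/-- **E-es-222 `PrimeLevelShimuraExponentLaw`** (THEOREM, T-es-83: `_holds := fun W _ _ _ _ D hopt hq h11 h17 ↦
ShimuraFive.two_mul_mem_or_three_mul_mem_primeLevel_of_ne W D hopt hq h11 h17`).  THE DERICKX–ORLIĆ EXPONENT LAW AT EVERY
PRIME LEVEL `q ∉ {11, 17}`: `2Λ₀(f) ⊆ Λ₁(f)` or `3Λ₀(f) ⊆ Λ₁(f)` (the kernel is cyclic of order `1`, `2` or `3`); `11a`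
(order `5`) and `17a` (order `4`) are the two exceptions. [cite: DerickxOrlic2025, Rmk. 4.8] [cite: LingOesterle1991, Thm. 1, Thm. 6] -/
@[conjecture]
def PrimeLevelShimuraExponentLaw : Prop :=
  ∀ (W : WeierstrassCurve ℚ) [W.IsElliptic] [W.IsGloballyMinimal] {q : ℕ} [NeZero q]
    (D : ModularParametrizationData W q), (∀ z ∈ D.L.lattice, ∃ w ∈ periodLattice D.f, z = D.c * w) →
    q.Prime → q ≠ 11 → q ≠ 17 →
    (∀ z ∈ periodLattice D.f, 2 * z ∈ periodLatticeGamma1 D.f) ∨ (∀ z ∈ periodLattice D.f, 3 * z ∈ periodLatticeGamma1 D.f)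

/-- **E-es-225 `PrimeLevelShimuraExponentLawAll`** (THEOREM, T-es-83 part 4 after REF1 §R241: `_holds := fun W _ _ _ _ D hq h11 h17 ↦
ShimuraFive.two_mul_mem_or_three_mul_mem_primeLevel_of_ne' W D hq h11 h17`).  E-es-222 for EVERY `X₀(q)`-datum of a globally minimal
curve — no lattice-optimality binder (the conclusion mentions only `f`). [cite: DerickxOrlic2025, Rmk. 4.8] -/
@[conjecture]
def PrimeLevelShimuraExponentLawAll : Prop :=
  ∀ (W : WeierstrassCurve ℚ) [W.IsElliptic] [W.IsGloballyMinimal] {q : ℕ} [NeZero q]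
    (D : ModularParametrizationData W q), q.Prime → q ≠ 11 → q ≠ 17 →
    (∀ z ∈ periodLattice D.f, 2 * z ∈ periodLatticeGamma1 D.f) ∨ (∀ z ∈ periodLattice D.f, 3 * z ∈ periodLatticeGamma1 D.f)

/-- Edge: the hopt-free law E-es-225 implies the lattice-optimal law E-es-222 (drop the unused lattice clause). [cite: DerickxOrlic2025, Rmk. 4.8] -/
theorem primeLevelShimuraExponentLaw_of_all (h : PrimeLevelShimuraExponentLawAll) : PrimeLevelShimuraExponentLaw :=
  fun W _ _ _ _ D _ hq h11 h17 ↦ h W D hq h11 h17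

/-- **E-es-223 `OddLevelFiveAtTwoTrivialKernel`** (THEOREM, T-es-83: `_holds := fun W₀ _ _ _ _ D₀ hopt hN2 hN11 ha ↦
ShimuraFive.periodLattice_le_gamma1_of_frobeniusTrace_two_eq_neg_two W₀ D₀ hopt hN2 hN11 ha`).  At odd level with `11 ∤ N`,
`a₂(W₀) = −2` (`#W̃₀(𝔽₂) = 5`) forces `Λ₀(f) = Λ₁(f)` (R5♯ = E-es-212 off `11 ∣ N`, and more: the kernel is trivial).
[cite: LingOesterle1991, Thm. 6] [cite: DerickxOrlic2025, Rmk. 4.8] -/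
@[conjecture]
def OddLevelFiveAtTwoTrivialKernel : Prop :=
  ∀ (W₀ : WeierstrassCurve ℚ) [W₀.IsElliptic] [W₀.IsGloballyMinimal] {N : ℕ} [NeZero N]
    (D₀ : ModularParametrizationData W₀ N), (∀ z ∈ D₀.L.lattice, ∃ w ∈ periodLattice D₀.f, z = D₀.c * w) →
    ¬ 2 ∣ N → ¬ 11 ∣ N → W₀.frobeniusTrace 2 = -2 → ∀ z ∈ periodLattice D₀.f, z ∈ periodLatticeGamma1 D₀.f

/-- **E-es-224 `ShimuraFiveOnlyAtEleven`** (CONJECTURAL beyond print; nothing asserted).  The residual of R5♯ after E-es-221: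
an element of order `5` in the Shimura-cover kernel of a lattice-optimal `X₀(N)`-datum occurs ONLY at `N = 11` (E15: 1 of 1025
classes; at the 3 classes with `11 ∣ N`, `N > 11` and a rational `5`-torsion point the kernel is trivial).  Why it might fail:
an optimal curve of level `11·M` with `W[5] ≅ ℤ/5 ⊕ μ₅` whose `μ₅` lies in the Shimura subgroup of `J₀(11M)`.
[cite: Vatsal2005, Rem. 1.8, Thm. 1.10] [cite: LingOesterle1991, §1] -/
@[conjecture]
def ShimuraFiveOnlyAtEleven : Prop :=
  ∀ (W₀ : WeierstrassCurve ℚ) [W₀.IsElliptic] [W₀.IsGloballyMinimal] {N : ℕ} [NeZero N]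
    (D₀ : ModularParametrizationData W₀ N), (∀ z ∈ D₀.L.lattice, ∃ w ∈ periodLattice D₀.f, z = D₀.c * w) →
    ¬ ShimuraIndexPrimeTo 5 D₀.f → N = 11

/-- E-es-224 refines E-es-221. -/
theorem elevenDividesLevelOfShimuraFive_of_onlyAtEleven (h : ShimuraFiveOnlyAtEleven) : ElevenDividesLevelOfShimuraFive := by
  intro W₀ _ _ N _ D₀ hopt hS
  rw [h W₀ D₀ hopt hS]

end Summit.BirchSwinnertonDyer.Rank1Residual.ManinAdditive.EsG43

end
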